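import Literature.MathematicalPhysics.QuantumFieldTheory.PolymerReblocking
import Literature.Probability.Distributions.GaussianSeparatedFactorisation
import Mathlib.Probability.Independence.Integration
import HarnessLib

/-!
# The fluctuation integral as the expectation of a reblocking step

Instantiates the abstract single renormalisation-group step `PolymerActivity.rgMap` of
`PolymerReblocking` (Brydges–Slade V, Prop. 5.1.1) with the expectation that actually occurs:
two-field functionals `F(ζ, φ)` of a *fluctuation field* `ζ ∈ Z` (law `P`) and a *coarse field*
`φ ∈ Φ`, valued in `𝕜 = ℝ` or `ℂ`, form the `(Φ → 𝕜)`-algebra `Z → Φ → 𝕜` (functionals of `φ`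
alone are the `ζ`-constant ones: `algebraMap c = fun _ => c`), and the **fluctuation integral**

  `flucExp P F (φ) = ∫ F(ζ, φ) dP(ζ)`   (Bochner; `0` off the integrable functionals)

is the bare function `E : (Z → Φ → 𝕜) → (Φ → 𝕜)` of `rgMap`. We verify the two structural
hypotheses of `rgMap_spec` / `rgMap_union`:

* `flucExp_smul`, `flucExp_add_of_mem` — `E` is `(Φ → 𝕜)`-homogeneous everywhere and additive on
  the submodule `integrableFunctionals P` ("there is no `θ` operating on `Ĩ`, and this factor
  contains no fluctuation fields upon which `𝔼₊` can act"); hence **`flucExp_rgMap_spec`**: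
  `E((K ∘ (Ĩ+δI)^•)(π⁻¹V)) = (rgMap E π Ĩ δI K ∘ Ĩ̃^•)(V)` as soon as the reblocked activities are
  integrable — in particular (`flucExp_rgMap_spec_of_bounded`) when `δI(B)`, `K(X)` are measurable
  and bounded in `ζ` and `P` is finite.
* `flucExp_mul_of_mem_localFunctionals` — `E(FG) = E(F)E(G)` when, for each `φ`, `F(·, φ)` is a
  measurable function of `r₁(ζ)` and `G(·, φ)` of `r₂(ζ)` for two **independent** "restriction
  maps" `r₁ : Z → Z₁`, `r₂ : Z → Z₂` (`IndepFun r₁ r₂ P`: the finite-range property (1.40) of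
  Brydges–Slade — fluctuation fields over distant regions are independent); hence
  **`flucExp_rgMap_union`**: `rgMap E (U₁ ∪ U₂) = rgMap E U₁ · rgMap E U₂` for disjoint coarse
  polymers whose data (`δI`, `K`) are local with respect to `r₁`, `r₂` and `K` factorises.
* `gaussian_rgMap_union` — the case `Z = ℝ^ι`, `P = N(μ₀, S)`, `rᵢ` = restriction to index sets
  `I₁, I₂` with `S i j = 0` across (`indepFun_restrict_multivariateGaussian`): a covariance of
  range smaller than the separation of the two regions.

## References

* D. C. Brydges, G. Slade, *A renormalisation group method. V. A single renormalisation group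
  step*, J. Stat. Phys. 159 (2015) 589–667, §1.3 (1.40), Prop. 5.1.1. [BrydgesSlade2015RGV]
* R. Bauerschmidt, D. C. Brydges, G. Slade, *Introduction to a Renormalisation Group Method*,
  LNM 2242, Springer 2019, Ch. 4 (finite range and independence). [BauerschmidtBrydgesSlade2019RG]
-/

noncomputable section

namespace Literature.MathematicalPhysics.QuantumFieldTheory

open Finset MeasureTheory ProbabilityTheory

namespace Fluctuation

variable {Z : Type*} {Φ : Type*} {𝕜 : Type*} [RCLike 𝕜]

/-! ### Two-field functionals as an algebra over the coarse-field functionals -/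

/-- The coarse-field functionals sit inside the two-field functionals as the `ζ`-constant ones:
`algebraMap (Φ → 𝕜) (Z → Φ → 𝕜) c = fun _ => c`. [folklore] -/
theorem algebraMap_apply (c : Φ → 𝕜) (ζ : Z) : algebraMap (Φ → 𝕜) (Z → Φ → 𝕜) c ζ = c := rfl

/-- Scalar multiplication by a coarse-field functional is pointwise multiplication:
`(c • F)(ζ, φ) = c(φ) F(ζ, φ)`. [folklore] -/
theorem smul_apply_apply (c : Φ → 𝕜) (F : Z → Φ → 𝕜) (ζ : Z) (φ : Φ) : (c • F) ζ φ = c φ * F ζ φ := rfl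

variable (Φ 𝕜) in
/-- The **functionals local with respect to a restriction map** `r : Z → Z'`: for each `φ`,
`F(·, φ)` is a measurable function of `r(ζ)` (e.g. `r` = restriction of a lattice field to a region,
Brydges–Slade's `𝒩(X)`); a `(Φ → 𝕜)`-subalgebra. [cite: BrydgesSlade2015RGV, Def. 1.6.2 (field locality)] -/
def localFunctionals {Z' : Type*} [MeasurableSpace Z'] (r : Z → Z') :
    Subalgebra (Φ → 𝕜) (Z → Φ → 𝕜) where
  carrier := {F | ∀ φ, ∃ f : Z' → 𝕜, Measurable f ∧ ∀ ζ, F ζ φ = f (r ζ)}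
  mul_mem' := fun {F G} hF hG φ => by
    obtain ⟨f, mf, hf⟩ := hF φ
    obtain ⟨g, mg, hg⟩ := hG φ
    exact ⟨f * g, mf.mul mg, fun ζ => by show F ζ φ * G ζ φ = f (r ζ) * g (r ζ); rw [hf ζ, hg ζ]⟩
  add_mem' := fun {F G} hF hG φ => by
    obtain ⟨f, mf, hf⟩ := hF φ
    obtain ⟨g, mg, hg⟩ := hG φ
    exact ⟨f + g, mf.add mg, fun ζ => by show F ζ φ + G ζ φ = f (r ζ) + g (r ζ); rw [hf ζ, hg ζ]⟩
  algebraMap_mem' := fun c φ => ⟨fun _ => c φ, measurable_const, fun _ => rfl⟩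

/-- Membership in `localFunctionals`. [folklore] -/
theorem mem_localFunctionals {Z' : Type*} [MeasurableSpace Z'] {r : Z → Z'} {F : Z → Φ → 𝕜} :
    F ∈ localFunctionals Φ 𝕜 r ↔ ∀ φ, ∃ f : Z' → 𝕜, Measurable f ∧ ∀ ζ, F ζ φ = f (r ζ) := Iff.rfl

variable [MeasurableSpace Z]

/-! ### The fluctuation integral and its linearity -/

/-- **The fluctuation integral** `E F (φ) = ∫ F(ζ, φ) dP(ζ)` of a two-field functional: integrate
out the fluctuation field `ζ` at fixed coarse field `φ` (Brydges–Slade's `𝔼₊`, acting on `θ`-shifted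
functionals `θF(ζ, φ) = F(φ + ζ)` among others). [cite: BrydgesSlade2015RGV, §1.3] -/
def flucExp (P : Measure Z) (F : Z → Φ → 𝕜) : Φ → 𝕜 := fun φ => ∫ ζ, F ζ φ ∂P

/-- Unfolding `flucExp`. [folklore] -/
theorem flucExp_apply (P : Measure Z) (F : Z → Φ → 𝕜) (φ : Φ) : flucExp P F φ = ∫ ζ, F ζ φ ∂P := rfl

/-- **`(Φ → 𝕜)`-homogeneity of the fluctuation integral** (no integrability needed):
`E(c • F) = c · E(F)`. [cite: BrydgesSlade2015RGV, Prop. 5.1.1] -/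
theorem flucExp_smul (P : Measure Z) (c : Φ → 𝕜) (F : Z → Φ → 𝕜) :
    flucExp P (c • F) = c * flucExp P F := by
  funext φ
  simp only [flucExp, Pi.mul_apply, smul_apply_apply]
  exact integral_const_mul _ _

/-- On a probability space the fluctuation integral fixes the coarse-field functionals:
`E(algebraMap c) = c`; in particular `E 1 = 1`. [folklore] -/
theorem flucExp_algebraMap (P : Measure Z) [IsProbabilityMeasure P] (c : Φ → 𝕜) :
    flucExp P (algebraMap (Φ → 𝕜) (Z → Φ → 𝕜) c) = c := by
  funext φ
  simp [flucExp]

/-- `E 1 = 1` on a probability space. [folklore] -/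
theorem flucExp_one (P : Measure Z) [IsProbabilityMeasure P] : flucExp P (1 : Z → Φ → 𝕜) = 1 := by
  funext φ
  simp [flucExp]

/-- **The integrable two-field functionals**: `F(·, φ)` is `P`-integrable for every `φ`; a
`(Φ → 𝕜)`-submodule. [folklore] -/
def integrableFunctionals (P : Measure Z) : Submodule (Φ → 𝕜) (Z → Φ → 𝕜) where
  carrier := {F | ∀ φ, Integrable (fun ζ => F ζ φ) P}
  add_mem' := fun {F G} hF hG φ => by
    have h := (hF φ).add (hG φ)
    exact h
  zero_mem' := fun φ => by
    change Integrable (fun _ : Z => (0 : 𝕜)) P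
    exact integrable_zero _ _ _
  smul_mem' := fun c F hF φ => by
    have h := (hF φ).const_mul (c φ)
    exact h

/-- Membership in `integrableFunctionals`. [folklore] -/
theorem mem_integrableFunctionals {P : Measure Z} {F : Z → Φ → 𝕜} :
    F ∈ integrableFunctionals P ↔ ∀ φ, Integrable (fun ζ => F ζ φ) P := Iff.rfl

/-- **Additivity of the fluctuation integral on integrable functionals.** [folklore] -/
theorem flucExp_add_of_mem {P : Measure Z} {F G : Z → Φ → 𝕜} (hF : F ∈ integrableFunctionals P)
    (hG : G ∈ integrableFunctionals P) : flucExp P (F + G) = flucExp P F + flucExp P G := by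
  funext φ
  simp only [flucExp, Pi.add_apply]
  exact integral_add (hF φ) (hG φ)

/-! ### Bounded measurable functionals: a subalgebra of integrable ones -/

variable (Z Φ 𝕜) in
/-- The **bounded measurable** two-field functionals (for each `φ`: `F(·, φ)` measurable and
bounded): a `(Φ → 𝕜)`-subalgebra, integrable for every finite `P`. [folklore] -/
def boundedMeasurable : Subalgebra (Φ → 𝕜) (Z → Φ → 𝕜) where
  carrier := {F | ∀ φ, Measurable (fun ζ => F ζ φ) ∧ ∃ C : ℝ, ∀ ζ, ‖F ζ φ‖ ≤ C}
  mul_mem' := fun {F G} hF hG φ => by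
    obtain ⟨mF, CF, hCF⟩ := hF φ
    obtain ⟨mG, CG, hCG⟩ := hG φ
    refine ⟨mF.mul mG, CF * CG, fun ζ => ?_⟩
    change ‖F ζ φ * G ζ φ‖ ≤ CF * CG
    rw [norm_mul]
    exact mul_le_mul (hCF ζ) (hCG ζ) (norm_nonneg _) ((norm_nonneg _).trans (hCF ζ))
  add_mem' := fun {F G} hF hG φ => by
    obtain ⟨mF, CF, hCF⟩ := hF φ
    obtain ⟨mG, CG, hCG⟩ := hG φ
    refine ⟨mF.add mG, CF + CG, fun ζ => ?_⟩
    change ‖F ζ φ + G ζ φ‖ ≤ CF + CG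
    exact (norm_add_le _ _).trans (add_le_add (hCF ζ) (hCG ζ))
  algebraMap_mem' := fun c φ => ⟨measurable_const, ‖c φ‖, fun ζ => le_rfl⟩

/-- Membership in `boundedMeasurable`. [folklore] -/
theorem mem_boundedMeasurable {F : Z → Φ → 𝕜} :
    F ∈ boundedMeasurable Z Φ 𝕜 ↔ ∀ φ, Measurable (fun ζ => F ζ φ) ∧ ∃ C : ℝ, ∀ ζ, ‖F ζ φ‖ ≤ C := Iff.rfl

/-- Bounded measurable functionals are integrable for a finite measure. [folklore] -/
theorem integrable_of_mem_boundedMeasurable {P : Measure Z} [IsFiniteMeasure P] {F : Z → Φ → 𝕜}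
    (hF : F ∈ boundedMeasurable Z Φ 𝕜) : F ∈ integrableFunctionals P := by
  intro φ
  obtain ⟨mF, C, hC⟩ := hF φ
  exact (integrable_const C).mono' mF.aestronglyMeasurable (Filter.Eventually.of_forall hC)

/-! ### Reblocked activities built from a subalgebra stay in it -/

section Reblock

variable {Λ : Type*} [Fintype Λ] {Λ' : Type*} [DecidableEq Λ'] [DecidableEq Λ]
variable {A : Type*} [CommRing A] {S : Type*} [CommRing S] [Algebra S A]

/-- **Closure of a subalgebra under reblocking**: if `δI(B) ∈ T` for `π B ∈ W` and `K(X) ∈ T` for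
`X ⊆ π⁻¹W`, then the reblocked activity `reblock π (algebraMap ∘ Ĩ) (δI^• ∘ K)(W)` lies in `T`
(field locality / measurability / boundedness are inherited by `K⁽³⁾`).
[cite: BrydgesSlade2015RGV, Prop. 5.1.1] -/
theorem reblock_mem_subalgebra (T : Subalgebra S A) (π : Λ → Λ') (Inew : Λ → S) {δI : Λ → A}
    {K : PolymerActivity Λ A} {W : Finset Λ'} (hδ : ∀ B, π B ∈ W → δI B ∈ T)
    (hK : ∀ X ⊆ PolymerActivity.refinement π W, K X ∈ T) :
    PolymerActivity.reblock π (fun B => algebraMap S A (Inew B)) (PolymerActivity.blockProd δI * K) W ∈ T := by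
  rw [PolymerActivity.reblock_apply]
  refine Subalgebra.sum_mem T fun X hX => Subalgebra.mul_mem T ?_ ?_
  · exact Subalgebra.prod_mem T fun B _ => Subalgebra.algebraMap_mem T _
  · have hXW : X ⊆ PolymerActivity.refinement π W := mem_powerset.1 (mem_filter.1 hX).1
    rw [PolymerActivity.mul_apply]
    refine Subalgebra.sum_mem T fun Y hY => Subalgebra.mul_mem T ?_ ?_
    · have hYX : Y ⊆ X := mem_powerset.1 hY
      exact Subalgebra.prod_mem T fun B hB => hδ B (PolymerActivity.mem_refinement.1 (hXW (hYX hB)))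
    · exact hK (X \ Y) (sdiff_subset.trans hXW)

end Reblock

/-! ### The reblocking identity for the fluctuation integral -/

section Spec

variable {Λ : Type*} [Fintype Λ] {Λ' : Type*} [DecidableEq Λ'] [DecidableEq Λ]

/-- **Brydges–Slade V, Prop. 5.1.1 (first part) for the fluctuation integral**:
`E((K ∘ (Ĩ + δI)^•)(π⁻¹V)) = (rgMap E π Ĩ δI K ∘ Ĩ̃^•)(V)` with `E = flucExp P`, provided every
reblocked activity `reblock π Ĩ (δI^• ∘ K)(U)`, `U ⊆ V`, is integrable in `ζ` for each `φ`.
[cite: BrydgesSlade2015RGV, Prop. 5.1.1] -/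
theorem flucExp_rgMap_spec (P : Measure Z) (π : Λ → Λ') (Inew : Λ → Φ → 𝕜) (δI : Λ → Z → Φ → 𝕜)
    (K : PolymerActivity Λ (Z → Φ → 𝕜)) (V : Finset Λ')
    (hD : ∀ U ⊆ V, PolymerActivity.reblock π (fun B => algebraMap (Φ → 𝕜) (Z → Φ → 𝕜) (Inew B))
      (PolymerActivity.blockProd δI * K) U ∈ integrableFunctionals P) :
    flucExp P ((K * PolymerActivity.blockProd (fun B => algebraMap (Φ → 𝕜) (Z → Φ → 𝕜) (Inew B) + δI B))
        (PolymerActivity.refinement π V)) =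
      (PolymerActivity.rgMap (flucExp P) π Inew δI K * PolymerActivity.blockProd (PolymerActivity.coarsen π Inew)) V :=
  PolymerActivity.rgMap_spec (flucExp P) (integrableFunctionals P) (fun _ hF _ hG => flucExp_add_of_mem hF hG)
    (fun c F _ => flucExp_smul P c F) π Inew δI K V hD

/-- **The reblocking identity for bounded measurable data and a finite fluctuation law**: if
`δI(B)` (`π B ∈ V`) and `K(X)` (`X ⊆ π⁻¹V`) are bounded measurable in `ζ` for each `φ`, the
identity of `flucExp_rgMap_spec` holds unconditionally. [cite: BrydgesSlade2015RGV, Prop. 5.1.1] -/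
theorem flucExp_rgMap_spec_of_bounded (P : Measure Z) [IsFiniteMeasure P] (π : Λ → Λ')
    (Inew : Λ → Φ → 𝕜) {δI : Λ → Z → Φ → 𝕜} {K : PolymerActivity Λ (Z → Φ → 𝕜)} (V : Finset Λ')
    (hδ : ∀ B, π B ∈ V → δI B ∈ boundedMeasurable Z Φ 𝕜)
    (hK : ∀ X ⊆ PolymerActivity.refinement π V, K X ∈ boundedMeasurable Z Φ 𝕜) :
    flucExp P ((K * PolymerActivity.blockProd (fun B => algebraMap (Φ → 𝕜) (Z → Φ → 𝕜) (Inew B) + δI B))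
        (PolymerActivity.refinement π V)) =
      (PolymerActivity.rgMap (flucExp P) π Inew δI K * PolymerActivity.blockProd (PolymerActivity.coarsen π Inew)) V := by
  refine flucExp_rgMap_spec P π Inew δI K V fun U hUV => integrable_of_mem_boundedMeasurable ?_
  exact reblock_mem_subalgebra (boundedMeasurable Z Φ 𝕜) π Inew (fun B hB => hδ B (hUV hB))
    fun X hX => hK X (hX.trans (PolymerActivity.refinement_mono π hUV))

end Spec

/-! ### Local functionals of independent regions and the factorisation of `E` -/

section Local

variable {Z₁ : Type*} [MeasurableSpace Z₁] {Z₂ : Type*} [MeasurableSpace Z₂]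

/-- **Factorisation of the fluctuation integral over independent regions** (the finite-range
property (1.40) of Brydges–Slade, "`𝔼(FG) = 𝔼(F)𝔼(G)` for `F ∈ 𝒩(X)`, `G ∈ 𝒩(Y)`, `dist(X,Y)`
larger than the range"): if `r₁, r₂` are independent under `P` and `F`, `G` are local with respect
to `r₁`, `r₂`, then `E(FG) = E(F)E(G)` (no integrability hypothesis: Mathlib's
`IndepFun.integral_fun_comp_mul_comp`). [cite: BrydgesSlade2015RGV, §1.3 eq. (1.40)] -/
theorem flucExp_mul_of_mem_localFunctionals {P : Measure Z} {r₁ : Z → Z₁} {r₂ : Z → Z₂}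
    (hind : IndepFun r₁ r₂ P) (hr₁ : AEMeasurable r₁ P) (hr₂ : AEMeasurable r₂ P) {F G : Z → Φ → 𝕜}
    (hF : F ∈ localFunctionals Φ 𝕜 r₁) (hG : G ∈ localFunctionals Φ 𝕜 r₂) :
    flucExp P (F * G) = flucExp P F * flucExp P G := by
  funext φ
  obtain ⟨f, mf, hf⟩ := hF φ
  obtain ⟨g, mg, hg⟩ := hG φ
  simp only [flucExp, Pi.mul_apply, hf, hg]
  exact hind.integral_fun_comp_mul_comp hr₁ hr₂ mf.aestronglyMeasurable mg.aestronglyMeasurable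

variable {Λ : Type*} [Fintype Λ] {Λ' : Type*} [DecidableEq Λ'] [DecidableEq Λ]

/-- **Brydges–Slade V, Prop. 5.1.1 (second part) for the fluctuation integral — component
factorisation of `K⁽³⁾`.** Let `U₁, U₂` be disjoint coarse polymers and `r₁, r₂` independent
restriction maps under `P` such that `δI(B)` and `K(X)` are local w.r.t. `rᵢ` for `π B ∈ Uᵢ`,
`X ⊆ π⁻¹Uᵢ` (finite range: the fluctuation fields entering the data over `π⁻¹U₁` and over `π⁻¹U₂`
are independent), and let `K` factorise across `(π⁻¹U₁, π⁻¹U₂)`. Then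
`rgMap E (U₁ ∪ U₂) = rgMap E (U₁) · rgMap E (U₂)` for `E = flucExp P`.
[cite: BrydgesSlade2015RGV, Prop. 5.1.1] -/
theorem flucExp_rgMap_union {P : Measure Z} {r₁ : Z → Z₁} {r₂ : Z → Z₂} (hind : IndepFun r₁ r₂ P)
    (hr₁ : AEMeasurable r₁ P) (hr₂ : AEMeasurable r₂ P) (π : Λ → Λ') (Inew : Λ → Φ → 𝕜)
    {δI : Λ → Z → Φ → 𝕜} {K : PolymerActivity Λ (Z → Φ → 𝕜)} {U₁ U₂ : Finset Λ'} (hU : Disjoint U₁ U₂)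
    (hδ₁ : ∀ B, π B ∈ U₁ → δI B ∈ localFunctionals Φ 𝕜 r₁)
    (hδ₂ : ∀ B, π B ∈ U₂ → δI B ∈ localFunctionals Φ 𝕜 r₂)
    (hK₁ : ∀ X ⊆ PolymerActivity.refinement π U₁, K X ∈ localFunctionals Φ 𝕜 r₁)
    (hK₂ : ∀ X ⊆ PolymerActivity.refinement π U₂, K X ∈ localFunctionals Φ 𝕜 r₂)
    (hK : ∀ X₁ ⊆ PolymerActivity.refinement π U₁, ∀ X₂ ⊆ PolymerActivity.refinement π U₂,
      K (X₁ ∪ X₂) = K X₁ * K X₂) :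
    PolymerActivity.rgMap (flucExp P) π Inew δI K (U₁ ∪ U₂) =
      PolymerActivity.rgMap (flucExp P) π Inew δI K U₁ * PolymerActivity.rgMap (flucExp P) π Inew δI K U₂ :=
  PolymerActivity.rgMap_union (flucExp P) π Inew (localFunctionals Φ 𝕜 r₁) (localFunctionals Φ 𝕜 r₂) Set.univ
    (fun _ hF _ hG _ _ => flucExp_mul_of_mem_localFunctionals hind hr₁ hr₂ hF hG) hU hδ₁ hδ₂ hK₁ hK₂ hK
    (Set.mem_univ _) (Set.mem_univ _)

end Local

/-! ### Gaussian fluctuation fields with a covariance vanishing across two regions -/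

section Gaussian

variable {ι : Type*} [Fintype ι] [DecidableEq ι]
variable {Λ : Type*} [Fintype Λ] {Λ' : Type*} [DecidableEq Λ'] [DecidableEq Λ]

/-- **Component factorisation of the Gaussian reblocking step.** Fluctuation field
`ζ ∼ N(μ₀, S)` on `ℝ^ι` with `S i j = 0` for `i ∈ I₁`, `j ∈ I₂` (a covariance whose range is smaller
than the separation of the two index sets); data `δI(B)`, `K(X)` over `π⁻¹U₁` (resp. `π⁻¹U₂`)
measurable functions of `ζ|_{I₁}` (resp. `ζ|_{I₂}`) at each coarse field; `K` factorising across
`(π⁻¹U₁, π⁻¹U₂)`; `U₁ ∩ U₂ = ∅`. Then `rgMap E (U₁ ∪ U₂) = rgMap E U₁ · rgMap E U₂` for the Gaussian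
fluctuation integral `E = flucExp N(μ₀, S)`.
[cite: BrydgesSlade2015RGV, Prop. 5.1.1] [cite: BauerschmidtBrydgesSlade2019RG, Ch. 4] -/
theorem gaussian_rgMap_union (μ₀ : EuclideanSpace ℝ ι) {S : Matrix ι ι ℝ} (hS : S.PosSemidef)
    {I₁ I₂ : Finset ι} (hI : ∀ i ∈ I₁, ∀ j ∈ I₂, S i j = 0) (π : Λ → Λ') (Inew : Λ → Φ → 𝕜)
    {δI : Λ → EuclideanSpace ℝ ι → Φ → 𝕜} {K : PolymerActivity Λ (EuclideanSpace ℝ ι → Φ → 𝕜)}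
    {U₁ U₂ : Finset Λ'} (hU : Disjoint U₁ U₂)
    (hδ₁ : ∀ B, π B ∈ U₁ → δI B ∈ localFunctionals Φ 𝕜 (fun (x : EuclideanSpace ℝ ι) (i : ↥I₁) => x (i : ι)))
    (hδ₂ : ∀ B, π B ∈ U₂ → δI B ∈ localFunctionals Φ 𝕜 (fun (x : EuclideanSpace ℝ ι) (j : ↥I₂) => x (j : ι)))
    (hK₁ : ∀ X ⊆ PolymerActivity.refinement π U₁,
      K X ∈ localFunctionals Φ 𝕜 (fun (x : EuclideanSpace ℝ ι) (i : ↥I₁) => x (i : ι)))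
    (hK₂ : ∀ X ⊆ PolymerActivity.refinement π U₂,
      K X ∈ localFunctionals Φ 𝕜 (fun (x : EuclideanSpace ℝ ι) (j : ↥I₂) => x (j : ι)))
    (hK : ∀ X₁ ⊆ PolymerActivity.refinement π U₁, ∀ X₂ ⊆ PolymerActivity.refinement π U₂,
      K (X₁ ∪ X₂) = K X₁ * K X₂) :
    PolymerActivity.rgMap (flucExp (multivariateGaussian μ₀ S)) π Inew δI K (U₁ ∪ U₂) =
      PolymerActivity.rgMap (flucExp (multivariateGaussian μ₀ S)) π Inew δI K U₁ *
        PolymerActivity.rgMap (flucExp (multivariateGaussian μ₀ S)) π Inew δI K U₂ := by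
  have hm₁ : Measurable fun (x : EuclideanSpace ℝ ι) (i : ↥I₁) => x (i : ι) := by fun_prop
  have hm₂ : Measurable fun (x : EuclideanSpace ℝ ι) (j : ↥I₂) => x (j : ι) := by fun_prop
  exact flucExp_rgMap_union
    (Literature.Probability.Distributions.indepFun_restrict_multivariateGaussian μ₀ hS hI)
    hm₁.aemeasurable hm₂.aemeasurable π Inew hU hδ₁ hδ₂ hK₁ hK₂ hK

end Gaussian

end Fluctuation

end Literature.MathematicalPhysics.QuantumFieldTheory

end
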